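import Mathlib
import HarnessLib
import Summits.CriticalPhenomena.Ising3DConformalLimit.Theses.LeeYangGap
import Literature.Probability.LatticeModels.LeeYangFirstZeroMonotoneProofs
import Literature.Probability.LatticeModels.UrsellFirstZeroFromCurrents

/-!
# `FirstZeroAntitoneInBeta` holds (route LeeYangGap, item stmt-CriticalPhenomena-4947)

The support item `FirstZeroAntitoneInBeta` of route `CriticalPhenomena/Ising3DConformalLimit/LeeYangGap`
is the instance `G = zdGraph 3`, `Λ = box 3 M`, `B = box 3 L ⊆ box 3 M` (`L ≤ M`), `λ ≡ 1` of the
Literature fact `Literature.Probability.LatticeModels.CamiaJiangNewman.firstZero_antitone`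
(Camia–Jiang–Newman 2023, Theorem 2: the first Lee–Yang zero of
`θ ↦ ⟨cos(θ ∑_{u∈B} λ_u σ_u)⟩^{free}_{Λ;β,0}` is antitone in the coupling `β`), which the tree proves
as the composition of `CamiaJiangNewman.firstZero_antitone_of_thm2`
(`LeeYangFirstZeroMonotoneProofs.lean`) with `CamiaJiangNewman2023_thm2_holds`
(`UrsellFirstZeroFromCurrents.lean`); the same composition is `CamiaJiangNewman.firstZero_antitone_holds`
of `LeeYangFirstZeroMonotoneHolds.lean`.

References: [CamiaJiangNewman2023] F. Camia, J. Jiang, C. M. Newman, *Monotonicity of Ursell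
functions in the Ising model*, CMP 401 (2023) 2459–2482, arXiv:2207.12247, Thm 2 / Cor 1 (§1.2).
-/

namespace Summit.CriticalPhenomena.Ising3DConformalLimit.Theorems

open Literature.Probability.LatticeModels

/-- **Route item `FirstZeroAntitoneInBeta` (stmt-CriticalPhenomena-4947) holds.** For free-boundary
boxes `Λ_M = box 3 M` of `ℤ³`, `L ≤ M`, `0 ≤ β ≤ β'`: if `θ > 0` is a zero of
`θ ↦ ⟨cos(θ M_L)⟩^{free}_{Λ_M;β,0}` (`M_L = ∑_{x ∈ box 3 L} σ_x`) then
`θ' ↦ ⟨cos(θ' M_L)⟩^{free}_{Λ_M;β',0}` has a zero `θ' ∈ (0, θ]`. Specialisation of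
Camia–Jiang–Newman 2023, Theorem 2 (`CamiaJiangNewman.firstZero_antitone_of_thm2` applied to
`CamiaJiangNewman2023_thm2_holds`) to the graph `zdGraph 3`, the volume `box 3 M`, the block
`box 3 L` (`box_mono`) and the weights `λ ≡ 1` (`one_mul`).
[cite: CamiaJiangNewman2023, Theorem 2 and Corollary 1 (arXiv:2207.12247 §1.2)] -/
theorem firstZeroAntitoneInBeta_proof :
    Summit.CriticalPhenomena.Ising3DConformalLimit.Theses.LeeYangGap.FirstZeroAntitoneInBeta := by
  unfold Summit.CriticalPhenomena.Ising3DConformalLimit.Theses.LeeYangGap.FirstZeroAntitoneInBeta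
  intro M L β β' θ hLM hβ hββ' hθ hzero
  have h := CamiaJiangNewman.firstZero_antitone_of_thm2
    CamiaJiangNewman2023_thm2_holds (zdGraph 3) (box 3 M) (box 3 L)
    (box_mono 3 hLM) (fun _ => (1 : ℝ)) (fun _ _ => zero_le_one) β β' θ hβ hββ' hθ
  simp only [one_mul] at h
  exact h hzero

end Summit.CriticalPhenomena.Ising3DConformalLimit.Theorems
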